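import Mathlib
import Summits.Ventures.PercRepro2.Defs
import Summits.Ventures.PercRepro2.Graph
import Summits.Ventures.PercRepro2.Harris
import Summits.Ventures.PercRepro2.Events
import Summits.Ventures.PercRepro2.Independence
import Summits.Ventures.PercRepro2.Induced
import Summits.Ventures.PercRepro2.Exploration
import Summits.Ventures.PercRepro2.GateDefs
import Summits.Ventures.PercRepro2.GateAnatomy
import Summits.Ventures.PercRepro2.GateForest
import Summits.Ventures.PercRepro2.GateLSM
import Summits.Ventures.PercRepro2.HullTree
import Summits.Ventures.PercRepro2.GateFeedbackForest
import Summits.Ventures.PercRepro2.GateFeedback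
import Summits.Ventures.PercRepro2.GateFeedbackExit
import Summits.Ventures.PercRepro2.GateContract
import Summits.Ventures.PercRepro2.GateShadow
import Summits.Ventures.PercRepro2.GateSide
import Summits.Ventures.PercRepro2.GateSep
import Summits.Ventures.PercRepro2.SideCluster
import Summits.Ventures.PercRepro2.CactusDefs
import Summits.Ventures.PercRepro2.CactusTriangle
import Summits.Ventures.PercRepro2.CactusTriangleMass
import Summits.Ventures.PercRepro2.CactusCluster
import Summits.Ventures.PercRepro2.CactusDel
import Summits.Ventures.PercRepro2.CactusChain
import Summits.Ventures.PercRepro2.CactusKappa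
import Summits.Ventures.PercRepro2.GateSupport

/-!
# The support-chain theorem in κ-form and in the (t, w)-symmetric form
(blind cell PercRepro2, mine-c g11; proofs/MINEC-FEEDBACK.md §15)

`massB W = 1[t,u,w ∉ W] · ν(W) · κ(W)` with `κ(W) = P(t ↔ w in G ∖ W)` symmetric in `t` and `w`.
The FKG lattice condition follows from (a) the cluster law log-supermodular on support pairs and
(κ) `κ` log-supermodular on support pairs (`massBLogSupermod_of_support_kappa`); (κ) follows from
the nesting of the components of the EXIT `w` in `G − t − W` (`GateSupport`) or, symmetrically,
from the nesting of the components of the AVOIDED vertex `t` in `G − w − W`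
(`kappa_lsm_of_dichotomy'`), pair by pair (`massBLogSupermod_of_support'`, `gateRow_of_support'`).
-/

namespace Summit.Ventures.PercRepro2

namespace GateSupport

open Cactus CactusChain CactusGate GateSide

open scoped Classical

variable {V : Type*} {E : Type*} [Fintype E] [Fintype V]
variable {R : Type*} [Field R] [LinearOrder R] [IsStrictOrderedRing R]
variable {ends : E → Sym2 V}

/-- **The support theorem, κ-form**: the cluster law and `κ` log-supermodular on pairs of clusters
of nonzero class-B mass give the FKG lattice condition. -/
theorem massBLogSupermod_of_support_kappa {p : E → R} (hp : IsProbVec p) {s t u w : V}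
    (hν : ∀ W₁ W₂ : Finset V, GateLSM.massB p ends s t u w W₁ ≠ 0 →
      GateLSM.massB p ends s t u w W₂ ≠ 0 →
      prob p (clusterEvent ends s (↑W₁ : Set V)) * prob p (clusterEvent ends s (↑W₂ : Set V)) ≤
        prob p (clusterEvent ends s (↑(W₁ ∩ W₂) : Set V)) *
          prob p (clusterEvent ends s (↑(W₁ ∪ W₂) : Set V)))
    (hκ : ∀ W₁ W₂ : Finset V, GateLSM.massB p ends s t u w W₁ ≠ 0 →
      GateLSM.massB p ends s t u w W₂ ≠ 0 →
      prob p (connDelEvent ends W₁ t w) * prob p (connDelEvent ends W₂ t w) ≤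
        prob p (connDelEvent ends (W₁ ∩ W₂) t w) * prob p (connDelEvent ends (W₁ ∪ W₂) t w)) :
    GateLSM.MassBLogSupermod p ends s t u w := by
  intro W₁ W₂
  have hnn : ∀ W, 0 ≤ GateLSM.massB p ends s t u w W := fun W => prob_nonneg hp _
  by_cases hz₁ : GateLSM.massB p ends s t u w W₁ = 0
  · rw [hz₁, zero_mul]; exact mul_nonneg (hnn _) (hnn _)
  by_cases hz₂ : GateLSM.massB p ends s t u w W₂ = 0
  · rw [hz₂, mul_zero]; exact mul_nonneg (hnn _) (hnn _)
  obtain ⟨ht₁, hu₁, hw₁⟩ := notMem_of_massB_ne_zero hz₁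
  obtain ⟨ht₂, hu₂, hw₂⟩ := notMem_of_massB_ne_zero hz₂
  have hI : ¬ (t ∈ W₁ ∩ W₂ ∨ u ∈ W₁ ∩ W₂ ∨ w ∈ W₁ ∩ W₂) := by
    rintro (h | h | h)
    · exact ht₁ (Finset.mem_inter.1 h).1
    · exact hu₁ (Finset.mem_inter.1 h).1
    · exact hw₁ (Finset.mem_inter.1 h).1
  have hU : ¬ (t ∈ W₁ ∪ W₂ ∨ u ∈ W₁ ∪ W₂ ∨ w ∈ W₁ ∪ W₂) := by
    rintro (h | h | h)
    · rcases Finset.mem_union.1 h with h | h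
      · exact ht₁ h
      · exact ht₂ h
    · rcases Finset.mem_union.1 h with h | h
      · exact hu₁ h
      · exact hu₂ h
    · rcases Finset.mem_union.1 h with h | h
      · exact hw₁ h
      · exact hw₂ h
  have hA := hν W₁ W₂ hz₁ hz₂
  have hC := hκ W₁ W₂ hz₁ hz₂
  have hν0 : ∀ W, 0 ≤ prob p (clusterEvent ends s (↑W : Set V)) := fun W => prob_nonneg hp _
  have hκ0 : ∀ W, 0 ≤ prob p (connDelEvent ends W t w) := fun W => prob_nonneg hp _
  rw [GateSep.massB_eq_connDel p ends s t u w W₁, GateSep.massB_eq_connDel p ends s t u w W₂,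
    GateSep.massB_eq_connDel p ends s t u w (W₁ ∩ W₂),
    GateSep.massB_eq_connDel p ends s t u w (W₁ ∪ W₂),
    if_neg (by simp only [not_or]; exact ⟨ht₁, hu₁, hw₁⟩),
    if_neg (by simp only [not_or]; exact ⟨ht₂, hu₂, hw₂⟩), if_neg hI, if_neg hU]
  calc prob p (clusterEvent ends s (↑W₁ : Set V)) * prob p (connDelEvent ends W₁ t w) *
        (prob p (clusterEvent ends s (↑W₂ : Set V)) * prob p (connDelEvent ends W₂ t w))
      = (prob p (clusterEvent ends s (↑W₁ : Set V)) * prob p (clusterEvent ends s (↑W₂ : Set V))) *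
        (prob p (connDelEvent ends W₁ t w) * prob p (connDelEvent ends W₂ t w)) := by ring
    _ ≤ (prob p (clusterEvent ends s (↑(W₁ ∩ W₂) : Set V)) *
          prob p (clusterEvent ends s (↑(W₁ ∪ W₂) : Set V))) *
        (prob p (connDelEvent ends (W₁ ∩ W₂) t w) * prob p (connDelEvent ends (W₁ ∪ W₂) t w)) :=
        mul_le_mul hA hC (mul_nonneg (hκ0 _) (hκ0 _)) (mul_nonneg (hν0 _) (hν0 _))
    _ = _ := by ring

/-- **The dichotomy for the avoided vertex** (components of `t` in `G − w − W`) gives the same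
inequality for `κ`, by the `(t, w)`-symmetry of `κ`. -/
theorem kappa_lsm_of_dichotomy' {p : E → R} (hp : IsProbVec p) {t w : V} {W₁ W₂ : Finset V}
    (hw₁ : w ∉ W₁) (hw₂ : w ∉ W₂) (hwt : w ≠ t)
    (hd : (∀ y ∈ W₂, ¬ Conn ends (delCfg ends (GateFeedback.Ft ends w) (↑W₁ : Set V)) t y) ∨
      (∀ y ∈ W₁, ¬ Conn ends (delCfg ends (GateFeedback.Ft ends w) (↑W₂ : Set V)) t y)) :
    prob p (connDelEvent ends W₁ t w) * prob p (connDelEvent ends W₂ t w) ≤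
      prob p (connDelEvent ends (W₁ ∩ W₂) t w) * prob p (connDelEvent ends (W₁ ∪ W₂) t w) := by
  rw [GateSep.connDelEvent_comm ends W₁ t w, GateSep.connDelEvent_comm ends W₂ t w,
    GateSep.connDelEvent_comm ends (W₁ ∩ W₂) t w, GateSep.connDelEvent_comm ends (W₁ ∪ W₂) t w]
  exact kappa_lsm_of_dichotomy hp hw₁ hw₂ hwt.symm hd

/-- **The support-chain theorem, symmetric form**: pair by pair, EITHER the components of the exit
`w` in `G − t − W` OR the components of the avoided vertex `t` in `G − w − W` are nested. -/
theorem massBLogSupermod_of_support' {p : E → R} (hp : IsProbVec p) {s t u w : V} (hw : w ≠ t)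
    (hν : ∀ W₁ W₂ : Finset V, GateLSM.massB p ends s t u w W₁ ≠ 0 →
      GateLSM.massB p ends s t u w W₂ ≠ 0 →
      prob p (clusterEvent ends s (↑W₁ : Set V)) * prob p (clusterEvent ends s (↑W₂ : Set V)) ≤
        prob p (clusterEvent ends s (↑(W₁ ∩ W₂) : Set V)) *
          prob p (clusterEvent ends s (↑(W₁ ∪ W₂) : Set V)))
    (hχ : ∀ W₁ W₂ : Finset V, GateLSM.massB p ends s t u w W₁ ≠ 0 →
      GateLSM.massB p ends s t u w W₂ ≠ 0 →
      ((∀ y ∈ W₂, ¬ Conn ends (delCfg ends (GateFeedback.Ft ends t) (↑W₁ : Set V)) w y) ∨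
        (∀ y ∈ W₁, ¬ Conn ends (delCfg ends (GateFeedback.Ft ends t) (↑W₂ : Set V)) w y)) ∨
      ((∀ y ∈ W₂, ¬ Conn ends (delCfg ends (GateFeedback.Ft ends w) (↑W₁ : Set V)) t y) ∨
        (∀ y ∈ W₁, ¬ Conn ends (delCfg ends (GateFeedback.Ft ends w) (↑W₂ : Set V)) t y))) :
    GateLSM.MassBLogSupermod p ends s t u w := by
  refine massBLogSupermod_of_support_kappa hp hν fun W₁ W₂ hz₁ hz₂ => ?_
  obtain ⟨ht₁, _, hw₁⟩ := notMem_of_massB_ne_zero hz₁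
  obtain ⟨ht₂, _, hw₂⟩ := notMem_of_massB_ne_zero hz₂
  rcases hχ W₁ W₂ hz₁ hz₂ with hd | hd
  · exact kappa_lsm_of_dichotomy hp ht₁ ht₂ hw hd
  · exact kappa_lsm_of_dichotomy' hp hw₁ hw₂ hw hd

/-- **The free gate from the symmetric support conditions** (every graph). -/
theorem gateRow_of_support' {p : E → R} (hp : IsProbVec p) (s t a b u w : V) (hw : w ≠ t)
    (hν : ∀ W₁ W₂ : Finset V, GateLSM.massB p ends s t u w W₁ ≠ 0 →
      GateLSM.massB p ends s t u w W₂ ≠ 0 →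
      prob p (clusterEvent ends s (↑W₁ : Set V)) * prob p (clusterEvent ends s (↑W₂ : Set V)) ≤
        prob p (clusterEvent ends s (↑(W₁ ∩ W₂) : Set V)) *
          prob p (clusterEvent ends s (↑(W₁ ∪ W₂) : Set V)))
    (hχ : ∀ W₁ W₂ : Finset V, GateLSM.massB p ends s t u w W₁ ≠ 0 →
      GateLSM.massB p ends s t u w W₂ ≠ 0 →
      ((∀ y ∈ W₂, ¬ Conn ends (delCfg ends (GateFeedback.Ft ends t) (↑W₁ : Set V)) w y) ∨
        (∀ y ∈ W₁, ¬ Conn ends (delCfg ends (GateFeedback.Ft ends t) (↑W₂ : Set V)) w y)) ∨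
      ((∀ y ∈ W₂, ¬ Conn ends (delCfg ends (GateFeedback.Ft ends w) (↑W₁ : Set V)) t y) ∨
        (∀ y ∈ W₁, ¬ Conn ends (delCfg ends (GateFeedback.Ft ends w) (↑W₂ : Set V)) t y))) :
    Gate.GateRow p ends s {t} a b {u} {w} :=
  GateSep.gateRow_of_massBLogSupermod hp s t a b u w (massBLogSupermod_of_support' hp hw hν hχ)

end GateSupport

end Summit.Ventures.PercRepro2
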